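import Literature.Analysis.FluidPDE.NSSuitableESS
import Literature.Analysis.FluidPDE.VectorCalculus
import HarnessLib

/-!
# Kang–Nguyen 2022, Theorem 1.3: local regularity from ONE small velocity component at one scale
# (suitable weak solutions) — named fact

Analysis/FluidPDE facts file; cite item `wi-41504` of route
`NavierStokesRegularity/OneComponentPincer` (crux `OneComponentLocalCriticalBound`, support "BC5 rung").

## Source

K. Kang, D. D. Nguyen, *Local regularity criteria in terms of one velocity component for the
Navier–Stokes equations*, J. Math. Fluid Mech. 25 (2023), art. 16 = arXiv:2206.02490
[KangNguyen2022]. Conventions of the paper (§1): (NS) is `∂ₜv − Δv + v·∇v + ∇π = 0`, `div v = 0`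
(viscosity `1`, no force); `Q_r(z) = B_r(x) × (t − r², t)` for `z = (x, t)` (BACKWARD cylinders);
"`z` is a regular point of `v` if there exists `r > 0` such that `v ∈ L^∞(Q_r(z))`"; Def. 2.1: a
suitable weak solution in `Ω × I` has `v ∈ L^∞(I; L²(Ω)) ∩ L²(I; Ḣ¹(Ω))`, `π ∈ L^{3/2}(Ω × I)`,
solves (NS) in distributions and satisfies the local energy inequality.

**Theorem 1.3** (suitable weak case; PDF pp. 4–5): "Let `(v, π)` be a … suitable weak solution to
(NS) in `ℝ³ × (0, ∞)` associated with the divergence-free initial data `v₀ ∈ L²(ℝ³)` [in the sense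
`lim_{t→0} ‖v(t) − v₀‖_{L²(ℝ³)} = 0`, Thm. 1.1]. Let `z₀ = (x₀, t₀) ∈ ℝ³ × (0, ∞)`, `M > 0` and
`ε₀ ∈ (0, ε_W]`, where `ε_W` is the constant in (W) [Wolf 2015: `r⁻² ‖v‖³_{L³(Q_r)} ≤ ε_W ⇒
v ∈ L^∞(Q_{r/2})`]. There exist `ε(M, ε₀)` and `δ₀(M, ε₀) ∈ (0, 1)` with the following property.
For some `0 < r₀ = r₀(M, ε₀, p, q) ≤ √t₀` if
`r₀⁻² (‖v‖³_{L³(Q_{r₀}(z₀))} + ‖π‖^{3/2}_{L^{3/2}(Q_{r₀}(z₀))}) ≤ M` and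
`r₀^{1 − 2/p − 3/q} ‖v₃‖_{L^p_t L^q_x(Q_{r₀}(z₀))} ≤ ε` for `1 ≤ p, q ≤ ∞`
hold then (W) follows [`(δ₀ r₀)⁻² ‖v‖³_{L³(Q_{δ₀ r₀}(z₀))} ≤ ε₀`] and `z₀` is a regular point of `v`."

## Rendering (every choice weakens or equals the printed statement)

* `ℝ³ = EuclideanSpace ℝ (Fin 3)`, space–time points time-first `(t, x) : ℝ × ℝ³` as everywhere in
  this directory; `Q_r(z) = parabolicCylinder r z` (backward), the scaled quantities
  `r⁻² ‖v‖³_{L³(Q_r(z))} = cknC r z v`, `r⁻² ‖π‖^{3/2}_{L^{3/2}(Q_r(z))} = cknD r z π`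
  (`SuitableWeak.lean`).
* "suitable weak solution to (NS) in `ℝ³ × (0, ∞)`" (Def. 2.1) = the tree's local notion
  `IsSuitableWeakSolutionOn (forwardCylinder ⊤ 0) 1 0 v π` (CKN/Lin: distributional solution,
  local classes, integrated local energy inequality) PLUS Def. 2.1's global classes on
  `ℝ³ × (0, ∞)` as separate hypotheses (`v ∈ L^∞_t L²_x`, a weak spatial gradient in `L²_{t,x}`,
  `π ∈ L^{3/2}_{t,x}`); the sliced form of the energy inequality in Def. 2.1 versus the integrated
  form of the tree is the folklore equivalence recorded in `LocalTypeI.lean` / `NSSuitableESS.lean`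
  and is not bridged here (same rendering as `IsSuitableWeakSolutionInBall`).
* The initial datum: `v₀ ∈ L²` (`MemLp v₀ 2`), weakly divergence free (`IsWeaklyDivFree`),
  attained in `L²` as `t ↓ 0`.  (The proof for suitable weak solutions is local in `Q_{r₀}(z₀)` —
  §5, "`E^n(r) ≤ C(1 + M)` for `r = r₀/2`" — but the theorem is printed for global solutions with
  data, and is vendored so.)
* Exponents `p, q ∈ [1, ∞]` as `ℝ≥0∞` with `1 ≤ p`, `1 ≤ q`; the scaling exponent
  `1 − 2/p − 3/q` is the real number `1 − 2 (p⁻¹).toReal − 3 (q⁻¹).toReal` (`∞⁻¹ = 0`).  The mixed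
  norm `‖v₃‖_{L^p_t L^q_x(Q_{r₀}(z₀))}` is the `L^p(t₀ − r₀², t₀)`-norm of
  `t ↦ ‖v₃(t, ·)‖_{L^q(B_{r₀}(x₀))}`, with the inner norms required finite for a.e. `t` (so that
  `toReal` is faithful; where they are infinite the printed hypothesis fails anyway).  `v₃` is the
  third Cartesian component `(v t x) 2` as printed (any fixed direction is the same statement
  after a rotation, which is NOT performed here).
* Constants: `ε` and `δ₀ ∈ (0, 1)` are allowed to depend on `(p, q, M, ε₀)` (printed: on
  `(M, ε₀)`), uniformly in the solution, `z₀` and `r₀ ∈ (0, √t₀]`.  The threshold `ε_W` is not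
  vendored: the conclusion is stated for EVERY `ε₀ > 0` — for `ε₀ > ε_W` it follows from the
  printed case `ε₀ = ε_W`.  "Regular point" is the paper's (backward-cylinder) notion:
  `v` essentially bounded on some `Q_r(z₀)`, `r > 0` — weaker than the tree's centred
  `IsRegularPoint`.
* Not vendored here: the local-energy-solution case of Thm. 1.3, Thms. 1.1–1.2, and Remark 1.1(4)
  (the Type-I one-component criterion of Bae–Kang 2019, Appl. Math. Lett. 94 — a report of another
  paper's theorem; its own text is acquisition request acq-09211).
-/

noncomputable section

open MeasureTheory Set Function Filter Topology TopologicalSpace Metric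
open scoped NNReal ENNReal

namespace Literature.Analysis.FluidPDE

/-- Local notation for physical space `ℝ³ = EuclideanSpace ℝ (Fin 3)`. -/
local notation "ℝ³" => EuclideanSpace ℝ (Fin 3)

/-- **Kang–Nguyen 2022, Theorem 1.3 (suitable weak solutions): one small velocity component at one
scale gives regularity.**  For all `p, q ∈ [1, ∞]`, `M > 0`, `ε₀ > 0` there are `ε > 0` and
`δ₀ ∈ (0, 1)` such that: if `(v, π)` is a suitable weak solution of (NS) (`ν = 1`, no force) in
`ℝ³ × (0, ∞)` in the sense of the paper's Def. 2.1 (the tree's `IsSuitableWeakSolutionOn` on the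
forward region plus the global classes `v ∈ L^∞_t L²_x`, `∇v ∈ L²_{t,x}`, `π ∈ L^{3/2}_{t,x}`),
with a weakly divergence-free datum `v₀ ∈ L²(ℝ³)` attained in `L²` as `t ↓ 0`, and if at some
`z₀ = (t₀, x₀)`, `t₀ > 0`, and some scale `0 < r₀ ≤ √t₀` both
`r₀⁻² (‖v‖³_{L³(Q_{r₀}(z₀))} + ‖π‖^{3/2}_{L^{3/2}(Q_{r₀}(z₀))}) ≤ M` (`cknC + cknD ≤ M`) and
`r₀^{1 − 2/p − 3/q} ‖v₃‖_{L^p_t L^q_x(Q_{r₀}(z₀))} ≤ ε` hold, then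
`(δ₀ r₀)⁻² ‖v‖³_{L³(Q_{δ₀ r₀}(z₀))} ≤ ε₀` and `z₀` is a regular point of `v` (`v` is essentially
bounded on some backward cylinder `Q_r(z₀)`, `r > 0`).  Rendering choices: module docstring.
Statement only; users take `(h : KangNguyen2022_oneComponent_epsReg)`.
[cite: KangNguyen2022, Thm. 1.3 (suitable weak solution case), with Def. 2.1 and (W); arXiv:2206.02490 pp. 4–5] -/
def KangNguyen2022_oneComponent_epsReg : Prop :=
  ∀ (p q : ℝ≥0∞), 1 ≤ p → 1 ≤ q → ∀ (M ε₀ : ℝ), 0 < M → 0 < ε₀ →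
    ∃ ε : ℝ, 0 < ε ∧ ∃ δ₀ : ℝ, 0 < δ₀ ∧ δ₀ < 1 ∧
      ∀ (v : ℝ → ℝ³ → ℝ³) (π : ℝ → ℝ³ → ℝ) (v₀ : ℝ³ → ℝ³),
        -- `(v, π)` is a suitable weak solution of (NS), `ν = 1`, `f = 0`, in `ℝ³ × (0, ∞)` …
        IsSuitableWeakSolutionOn (forwardCylinder (⊤ : Opens ℝ³) 0) 1 0 v π →
        -- … with the global classes of KN Def. 2.1: `v ∈ L^∞(0,∞; L²(ℝ³))`,
        (∃ C : ℝ≥0, ∀ᵐ t ∂(volume.restrict (Ioi (0 : ℝ))), ∫⁻ x, ‖v t x‖ₑ ^ 2 ≤ C) →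
        -- `∇v ∈ L²(ℝ³ × (0, ∞))` (a weak spatial gradient, square integrable),
        (∃ G : ℝ → ℝ³ → ℝ³ →L[ℝ] ℝ³,
          HasWeakSpatialGradientOn (forwardCylinder (⊤ : Opens ℝ³) 0) v G ∧
          ∫⁻ z in Ioi (0 : ℝ) ×ˢ (univ : Set ℝ³), ENNReal.ofReal (frobeniusNormSq (G z.1 z.2)) < ∞) →
        -- `π ∈ L^{3/2}(ℝ³ × (0, ∞))`,
        MemLp (uncurry π) (3 / 2 : ℝ≥0∞) (volume.restrict (Ioi (0 : ℝ) ×ˢ (univ : Set ℝ³))) →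
        -- divergence-free initial datum `v₀ ∈ L²(ℝ³)` attained in `L²`: `‖v(t) − v₀‖_{L²} → 0`,
        MemLp v₀ 2 volume → IsWeaklyDivFree v₀ →
        Tendsto (fun t => eLpNorm (fun x => v t x - v₀ x) 2 volume) (𝓝[>] 0) (𝓝 0) →
        ∀ (t₀ : ℝ) (x₀ : ℝ³), 0 < t₀ → ∀ r₀ : ℝ, 0 < r₀ → r₀ ≤ Real.sqrt t₀ →
          -- the one-scale bound `r₀⁻² (‖v‖³_{L³(Q_{r₀})} + ‖π‖^{3/2}_{L^{3/2}(Q_{r₀})}) ≤ M`,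
          cknC r₀ (t₀, x₀) v + cknD r₀ (t₀, x₀) π ≤ ENNReal.ofReal M →
          -- smallness of ONE component in scaled `L^p_t L^q_x(Q_{r₀}(z₀))`:
          (∀ᵐ t ∂(volume.restrict (Ioo (t₀ - r₀ ^ 2) t₀)),
            eLpNorm (fun x => v t x 2) q (volume.restrict (ball x₀ r₀)) < ∞) →
          ENNReal.ofReal (r₀ ^ (1 - 2 * (p⁻¹).toReal - 3 * (q⁻¹).toReal)) *
              eLpNorm (fun t => (eLpNorm (fun x => v t x 2) q (volume.restrict (ball x₀ r₀))).toReal)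
                p (volume.restrict (Ioo (t₀ - r₀ ^ 2) t₀)) ≤ ENNReal.ofReal ε →
          -- conclusion: (W) at scale `δ₀ r₀` and `z₀` is a regular point (backward cylinder)
          cknC (δ₀ * r₀) (t₀, x₀) v ≤ ENNReal.ofReal ε₀ ∧
            ∃ r : ℝ, 0 < r ∧
              eLpNorm (uncurry v) ∞ (volume.restrict (parabolicCylinder r (t₀, x₀))) < ∞

end Literature.Analysis.FluidPDE

end
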